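import Mathlib
import Summits.NavierStokesRegularity.NavierStokesRegularity.Theorems.WakeRatchetTailRatchetRelayBordered
import HarnessLib

/-!
# `WakeRatchet.TailRatchet` (stmt-NavierStokesRegularity-21808): DECAY RATE of the normalised backward
# pantograph solution — the bordered inverse maps `Y_γ` into `X_γ` (`0 < γ ≤ ½`)

Support file for the crux `TailRatchet` (route `WakeRatchet`; MODEL lattice ODEs of Tao 2016 §1.2, §4 —
nothing in this file is a statement about the Navier–Stokes equations, and no item is closed here).

Context (files `…RelaySolvability`, `…RelaySolvabilityLimit`, `…RelayBordered`; census of stmt-21808,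
programme "R-lac", tail of step R-lac-2): the bordered linearised drain-free front problem
`L₀h + σ(1+t/2)e^{t} = f`, `h(0) = 0`, `h(−∞) = 0` is uniquely solvable on the bounded class
(`WakeRatchetRelayBordered`).  For the implicit function theorem one wants the inverse to act between the
WEIGHTED spaces `Y_γ = {f : |f| ≲ e^{γt}}` and `X_γ = {h : |h|, |h'| ≲ e^{γt}}` of the census.  This file
supplies the rate, sorry-free:

* `deriv_integrableOn_of_bounded` — the derivative `2e^{t/2}h(t/2) + f` of a bounded solution is integrable;
* `pantograph_decay` — **if `|f(t)| ≤ A e^{γt}` on `t ≤ 0` with `0 < γ ≤ ½`, and `h` is a bounded solution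
  (`|h| ≤ B`) with `h(t) → 0` at `−∞`, then `|h(t)| ≤ (4B + A/γ) e^{γt}`** (fundamental theorem on
  `(−∞,t]` and `∫_{(−∞,t]} e^{ks} = e^{kt}/k`);
* `pantograph_deriv_decay` — and then `|h'(t)| ≤ (2(4B + A/γ) + A) e^{γt}`: `h ∈ X_γ`.

With `…RelayBordered` this completes the LINEAR input of the lacunary-`Λ` construction: for `0 < γ ≤ ½` the
bordered operator is a bijection `{h ∈ X_γ : h(0) = 0} × ℝ → Y_γ ∩ {continuous}` (bounded `f ∈ Y_γ` are
integrable).  Remaining (census R-lac-3, R-lac-4): the `C¹` dependence of `G_δ(b,s)` on `(b,s,δ)` after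
fixing the dilation, and the IFT; fronts for lacunary `Λ` do NOT refute `TailRatchet` (needs `Λ → 1`).

HONEST FRAMING: elementary real analysis; MODEL lattice only; the construction item and the crux stay open.
-/

noncomputable section

set_option linter.dupNamespace false

namespace Summit.NavierStokesRegularity.NavierStokesRegularity.Theorems

namespace WakeRatchetRelayDecay

open MeasureTheory Set Filter Topology Real
open WakeRatchetRelayBordered

variable {f h : ℝ → ℝ} {A B γ : ℝ}

/-- The derivative `2e^{t/2}h(t/2) + f(t)` of a bounded solution is integrable on `(−∞,0]`. [folklore] -/
theorem deriv_integrableOn_of_bounded (hfi : IntegrableOn f (Iic 0)) (hcont : ContinuousOn h (Iic 0))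
    (hB : ∀ t : ℝ, t ≤ 0 → |h t| ≤ B) :
    IntegrableOn (fun t : ℝ => 2 * Real.exp (t / 2) * h (t / 2) + f t) (Iic 0) := by
  have := bordered_deriv_integrableOn (σ := 0) hfi hcont hB
  refine this.congr_fun (fun t _ => ?_) measurableSet_Iic
  ring

/-- `e^{γt}`-weights: for `t ≤ 0` and `γ ≤ k`, `e^{kt} ≤ e^{γt}`. [folklore] -/
theorem exp_mul_le_exp_mul_of_le {k γ t : ℝ} (hγk : γ ≤ k) (ht : t ≤ 0) :
    Real.exp (k * t) ≤ Real.exp (γ * t) :=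
  Real.exp_le_exp.2 (by nlinarith)

/-- **DECAY RATE.**  Let `0 < γ ≤ ½`, `|f(t)| ≤ Ae^{γt}` on `t ≤ 0` with `f` integrable there, and let `h`
be continuous and bounded (`|h| ≤ B`) on `(−∞,0]`, solving `h' = 2e^{t/2}h(t/2) + f` on `t < 0`, with
`h(t) → 0` as `t → −∞`.  Then `|h(t)| ≤ (4B + A/γ)e^{γt}` for every `t ≤ 0`.
[cite: Tao2016AveragedNS, §1.2 (dyadic model); cell vocabulary (weighted spaces of programme R-lac, census of stmt-21808)] -/
theorem pantograph_decay (hγ : 0 < γ) (hγ2 : γ ≤ 1 / 2) (hfA : ∀ t : ℝ, t ≤ 0 → |f t| ≤ A * Real.exp (γ * t))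
    (hfi : IntegrableOn f (Iic 0)) (hcont : ContinuousOn h (Iic 0))
    (hde : ∀ t : ℝ, t < 0 → HasDerivAt h (2 * Real.exp (t / 2) * h (t / 2) + f t) t)
    (hB : ∀ t : ℝ, t ≤ 0 → |h t| ≤ B) (hlim : Tendsto h atBot (𝓝 0)) {t : ℝ} (ht : t ≤ 0) :
    |h t| ≤ (4 * B + A / γ) * Real.exp (γ * t) := by
  have hB0 : 0 ≤ B := (abs_nonneg _).trans (hB 0 le_rfl)
  have hA0 : 0 ≤ A := by
    have := hfA 0 le_rfl
    rw [mul_zero, Real.exp_zero, mul_one] at this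
    exact (abs_nonneg _).trans this
  set G : ℝ → ℝ := fun s => 2 * Real.exp (s / 2) * h (s / 2) + f s with hG
  -- integrability of `G` on `(−∞, t]`
  have hGint0 : IntegrableOn G (Iic 0) := deriv_integrableOn_of_bounded hfi hcont hB
  have hGint : IntegrableOn G (Iic t) := hGint0.mono_set (Iic_subset_Iic.2 ht)
  -- fundamental theorem of calculus on `(−∞, t]`
  have hcw : ContinuousWithinAt h (Iic t) t := (hcont t ht).mono (Iic_subset_Iic.2 ht)
  have hFTC := integral_Iic_of_hasDerivAt_of_tendsto hcw
    (fun x hx => hde x (lt_of_lt_of_le hx ht)) hGint hlim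
  rw [sub_zero] at hFTC
  -- majorant on `(−∞, t]`
  have hmaj_int : IntegrableOn (fun s : ℝ => 2 * B * Real.exp ((1 / 2) * s) + A * Real.exp (γ * s)) (Iic t) :=
    ((integrableOn_exp_mul_Iic (by norm_num : (0 : ℝ) < 1 / 2) t).const_mul _).add
      ((integrableOn_exp_mul_Iic hγ t).const_mul _)
  have hle : ∀ s ∈ Iic t, ‖G s‖ ≤ 2 * B * Real.exp ((1 / 2) * s) + A * Real.exp (γ * s) := by
    intro s hs
    have hs0 : s ≤ 0 := le_trans hs ht
    rw [Real.norm_eq_abs]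
    calc |G s| ≤ |2 * Real.exp (s / 2) * h (s / 2)| + |f s| := abs_add_le _ _
      _ = 2 * Real.exp (s / 2) * |h (s / 2)| + |f s| := by
          rw [abs_mul, abs_mul, abs_two, abs_of_pos (Real.exp_pos _)]
      _ ≤ 2 * Real.exp (s / 2) * B + A * Real.exp (γ * s) :=
          add_le_add (mul_le_mul_of_nonneg_left (hB _ (by linarith)) (by positivity)) (hfA s hs0)
      _ = 2 * B * Real.exp ((1 / 2) * s) + A * Real.exp (γ * s) := by ring_nf
  have h1 : ‖∫ s in Iic t, G s‖ ≤ ∫ s in Iic t, ‖G s‖ := norm_integral_le_integral_norm _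
  have h2 : ∫ s in Iic t, ‖G s‖ ≤ ∫ s in Iic t, (2 * B * Real.exp ((1 / 2) * s) + A * Real.exp (γ * s)) :=
    setIntegral_mono_on hGint.norm hmaj_int measurableSet_Iic hle
  have h3 : ∫ s in Iic t, (2 * B * Real.exp ((1 / 2) * s) + A * Real.exp (γ * s)) =
      4 * B * Real.exp ((1 / 2) * t) + A / γ * Real.exp (γ * t) := by
    rw [integral_add ((integrableOn_exp_mul_Iic (by norm_num : (0 : ℝ) < 1 / 2) t).const_mul _)
      ((integrableOn_exp_mul_Iic hγ t).const_mul _), integral_const_mul, integral_const_mul,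
      integral_exp_mul_Iic (by norm_num : (0 : ℝ) < 1 / 2), integral_exp_mul_Iic hγ]
    field_simp
    ring
  have h4 : Real.exp ((1 / 2) * t) ≤ Real.exp (γ * t) := exp_mul_le_exp_mul_of_le hγ2 ht
  rw [← hFTC, ← Real.norm_eq_abs]
  calc ‖∫ s in Iic t, G s‖ ≤ 4 * B * Real.exp ((1 / 2) * t) + A / γ * Real.exp (γ * t) := by
        linarith [h1, h2, h3]
    _ ≤ 4 * B * Real.exp (γ * t) + A / γ * Real.exp (γ * t) := by
        have := mul_le_mul_of_nonneg_left h4 (by positivity : (0 : ℝ) ≤ 4 * B)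
        linarith
    _ = (4 * B + A / γ) * Real.exp (γ * t) := by ring

/-- **DECAY OF THE DERIVATIVE.**  Under the hypotheses of `pantograph_decay`, the right-hand side obeys
`|2e^{t/2}h(t/2) + f(t)| ≤ (2(4B + A/γ) + A) e^{γt}` on `t ≤ 0`: the solution lies in the weighted `C¹`
space `X_γ`. [folklore] -/
theorem pantograph_deriv_decay (hγ : 0 < γ) (hγ2 : γ ≤ 1 / 2)
    (hfA : ∀ t : ℝ, t ≤ 0 → |f t| ≤ A * Real.exp (γ * t))
    (hfi : IntegrableOn f (Iic 0)) (hcont : ContinuousOn h (Iic 0))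
    (hde : ∀ t : ℝ, t < 0 → HasDerivAt h (2 * Real.exp (t / 2) * h (t / 2) + f t) t)
    (hB : ∀ t : ℝ, t ≤ 0 → |h t| ≤ B) (hlim : Tendsto h atBot (𝓝 0)) {t : ℝ} (ht : t ≤ 0) :
    |2 * Real.exp (t / 2) * h (t / 2) + f t| ≤ (2 * (4 * B + A / γ) + A) * Real.exp (γ * t) := by
  have hB0 : 0 ≤ B := (abs_nonneg _).trans (hB 0 le_rfl)
  have hA0 : 0 ≤ A := by
    have := hfA 0 le_rfl
    rw [mul_zero, Real.exp_zero, mul_one] at this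
    exact (abs_nonneg _).trans this
  have hh := pantograph_decay hγ hγ2 hfA hfi hcont hde hB hlim (show t / 2 ≤ 0 by linarith)
  -- `e^{t/2} e^{γt/2} ≤ e^{γt}` on `t ≤ 0`
  have hexp : Real.exp (t / 2) * Real.exp (γ * (t / 2)) ≤ Real.exp (γ * t) := by
    rw [← Real.exp_add]
    exact Real.exp_le_exp.2 (by nlinarith)
  have hK : 0 ≤ 4 * B + A / γ := by positivity
  calc |2 * Real.exp (t / 2) * h (t / 2) + f t| ≤ |2 * Real.exp (t / 2) * h (t / 2)| + |f t| :=
        abs_add_le _ _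
    _ = 2 * Real.exp (t / 2) * |h (t / 2)| + |f t| := by
        rw [abs_mul, abs_mul, abs_two, abs_of_pos (Real.exp_pos _)]
    _ ≤ 2 * Real.exp (t / 2) * ((4 * B + A / γ) * Real.exp (γ * (t / 2))) + A * Real.exp (γ * t) :=
        add_le_add (mul_le_mul_of_nonneg_left hh (by positivity)) (hfA t ht)
    _ = 2 * (4 * B + A / γ) * (Real.exp (t / 2) * Real.exp (γ * (t / 2))) + A * Real.exp (γ * t) := by
        ring
    _ ≤ 2 * (4 * B + A / γ) * Real.exp (γ * t) + A * Real.exp (γ * t) := by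
        have := mul_le_mul_of_nonneg_left hexp (by positivity : (0 : ℝ) ≤ 2 * (4 * B + A / γ))
        linarith
    _ = (2 * (4 * B + A / γ) + A) * Real.exp (γ * t) := by ring

end WakeRatchetRelayDecay

end Summit.NavierStokesRegularity.NavierStokesRegularity.Theorems

end
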